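import Summits.CriticalPhenomena.PercolationContinuityZ3.Theorems.PercNearOneGluingNoHeavyLowerTailFKAnalogues
import Literature.Probability.Percolation.TwoSetConditionalAssociationRC
import HarnessLib

/-!
# `FK.ClusterCPAFK q` holds for every `q ≥ 1` — the vdBHK input of the chain transplants to all monotone random-cluster measures

Helper file (`--supports stmt-CriticalPhenomena-4575 --as helper`), FK sub-lane `prim-bschramm-fk-1`; builds on p205010 (kernel theorem,
internal audit signed; external expert review pending).  The FK(`q`) analogue `FK.ClusterCPAFK q` (file
`PercNearOneGluingNoHeavyLowerTailFKAnalogues.lean`) of van den Berg–Häggström–Kahn's Theorem 1.3 — the one-cluster conditional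
positive association given `{s ↮ X}`, the printed input of Lemma T and of (S5) ⇒ (GEN) in the CSH ⇒ AdditiveGluing chain — is a
THEOREM for every `q ≥ 1`: it is the literature-prover's `BHK2006_clusterConditionalPositiveAssociation_rc` (vdBHK 2006 Thm. 2.1 ⇒
Thm. 1.3 for `φ_{𝐩,q} = rcMeasureW w q ∅`, `Literature/Probability/Percolation/TwoSetConditionalAssociationRC.lean`, p207949) read on the
vertex types `Fin n`.  So this link of the finite half of the chain is NOT where the large-`q` first-order barrier
(`Literature.Barriers.CriticalPhenomena.RandomClusterFirstOrder`) can bite.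
[cite: VandenbergHaggstromKahn2005, Thm. 1.3 (p. 6); Thm. 2.1 (p. 9)] [cite: Grimmett2006, §1.4 eq. (1.20) (p. 15)]
-/

namespace Summit.CriticalPhenomena.PercolationContinuityZ3.Theorems

namespace FK

open Literature.Probability.Percolation

/-- **`ClusterCPAFK q` for every `q ≥ 1`**: van den Berg–Häggström–Kahn's Theorem 1.3 holds for the random-cluster measures
`φ_{w,q}`, `q ≥ 1`, on all finite weighted graphs (by their Theorem 2.1, proved in the tree for `rcMeasureW`).
[cite: VandenbergHaggstromKahn2005, Thm. 1.3 (p. 6); Thm. 2.1 (p. 9)] -/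
theorem clusterCPAFK_of_one_le {q : ℝ} (hq : 1 ≤ q) : ClusterCPAFK q :=
  fun _ w s X F G hF hG _ => BHK2006_clusterConditionalPositiveAssociation_rc w hq s X F G hF hG

/-- In particular the FK–Ising case `q = 2`. [cite: VandenbergHaggstromKahn2005, Thm. 2.1 (p. 9)] -/
theorem clusterCPAFK_two : ClusterCPAFK 2 := clusterCPAFK_of_one_le (by norm_num)

end FK

end Summit.CriticalPhenomena.PercolationContinuityZ3.Theorems
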